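import Mathlib.Topology.Order.Basic
import Mathlib.Topology.Algebra.Order.LiminfLimsup
import Mathlib.Order.ConditionallyCompleteLattice.Basic
import Mathlib.Topology.Order.OrderClosed
import Mathlib.Analysis.SpecificLimits.Basic

/-!
# Route PhotonSphereChannels — the sweep bookkeeping of a monotone Killing-extension march
# ("real induction"): conquered radii that are upward closed, closed under infima and locally
# lowerable above the wall reach the wall

Helper file `--supports stmt-FinalStateConjecture-17430` (crux `ChannelsResolveTameDevelopmentsR`, K2R-T2):
the order-theoretic skeleton `march_reaches_wall` of the crux-ideate round-2 card
`legitimate-flanks-photon-wall` (`Cruxes/ChannelsResolveTameDevelopmentsR/Ideas/legitimate-flanks-photon-wall.md`,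
first lemma (b); the ideator's folder sketch is not mounted in a lead's jail, so it is re-proved here in
the form the card describes): the set `S ⊆ ℝ` of "conquered" leaf levels of a sweep is

* upward closed (a leaf above a conquered leaf is conquered),
* closed under infima / descending limits (the union of the conquered regions is conquered), and
* locally lowerable above the wall `w` (the local extension step — Ionescu–Klainerman across a strongly
  null-convex leaf — lowers any conquered level `c > w` a little);

then every level `c > w` is conquered (`PhotonWall.march_reaches_wall`), and if moreover the wall level
itself is a descending limit it is conquered too (`PhotonWall.march_reaches_wall_Ici`).  Pure order
theory on `ℝ` (least-counterexample / infimum argument); the analytic content of the card's stub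
"OuterFlank" is entirely in instantiating the three hypotheses.  No definitions. [folklore]
-/

noncomputable section

namespace Summit.FinalStateConjecture.FinalStateConjecture.Theorems

-- every `Summit.FinalStateConjecture.FinalStateConjecture.…` name repeats the summit = sub-problem
-- segment (D-0017 layout), as in every landed `…Theorems` file of this route
set_option linter.dupNamespace false

namespace PhotonWall

open Set

/-- **The march reaches the wall (infimum form).** Let `S ⊆ ℝ` be non-empty, upward closed, closed
under infima (`c = inf` of members of `S` lying above `c` ⇒ `c ∈ S`), and locally lowerable above `w`
(every `c ∈ S` with `w < c` admits `c' ∈ S`, `c' < c`).  Then `(w, ∞) ⊆ S`. [folklore] -/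
theorem march_reaches_wall :
    ∀ (S : Set ℝ) (w : ℝ), S.Nonempty → (∀ c ∈ S, ∀ c' : ℝ, c ≤ c' → c' ∈ S) →
      (∀ c : ℝ, (∀ s ∈ S, c ≤ s) → (∀ ε > (0 : ℝ), ∃ s ∈ S, s < c + ε) → c ∈ S) →
      (∀ c ∈ S, w < c → ∃ c' ∈ S, c' < c) → Set.Ioi w ⊆ S := by
  intro S w hne hup hinf hlow c hc
  rw [mem_Ioi] at hc
  by_contra hcS
  -- `c` is a strict lower bound of `S`
  have hlb : ∀ s ∈ S, c < s := fun s hs ↦ by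
    by_contra h
    exact hcS (hup s hs c (not_lt.1 h))
  have hbdd : BddBelow S := ⟨c, fun s hs ↦ (hlb s hs).le⟩
  -- the infimum `m ≥ c > w` is conquered …
  set m := sInf S with hm
  have hcm : c ≤ m := le_csInf hne fun s hs ↦ (hlb s hs).le
  have hmS : m ∈ S := by
    refine hinf m (fun s hs ↦ csInf_le hbdd hs) fun ε hε ↦ ?_
    obtain ⟨s, hs, hsε⟩ := exists_lt_of_csInf_lt hne (lt_add_of_pos_right m hε)
    exact ⟨s, hs, hsε⟩
  -- … and can be lowered: contradiction with minimality
  obtain ⟨c', hc'S, hc'm⟩ := hlow m hmS (lt_of_lt_of_le hc hcm)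
  exact absurd (csInf_le hbdd hc'S) (not_le.2 hc'm)

/-- **The march reaches the wall (closed form).** The same with "closed under infima" replaced by
`IsClosed S`. [folklore] -/
theorem march_reaches_wall_of_isClosed {S : Set ℝ} {w : ℝ} (hne : S.Nonempty)
    (hup : ∀ c ∈ S, ∀ c' : ℝ, c ≤ c' → c' ∈ S) (hclosed : IsClosed S)
    (hlow : ∀ c ∈ S, w < c → ∃ c' ∈ S, c' < c) : Set.Ioi w ⊆ S := by
  refine march_reaches_wall S w hne hup (fun c hlb happrox ↦ ?_) hlow
  have hbdd : BddBelow S := ⟨c, hlb⟩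
  have hc : c = sInf S := by
    refine le_antisymm (le_csInf hne hlb) ?_
    refine le_of_forall_pos_lt_add fun ε hε ↦ ?_
    obtain ⟨s, hs, hsε⟩ := happrox ε hε
    exact lt_of_le_of_lt (csInf_le hbdd hs) hsε
  rw [hc]
  exact hclosed.csInf_mem hne hbdd

/-- **… including the wall level** when it is itself a descending limit of conquered levels: under the
hypotheses of `march_reaches_wall`, `[w, ∞) ⊆ S`. [folklore] -/
theorem march_reaches_wall_Ici {S : Set ℝ} {w : ℝ} (hne : S.Nonempty)
    (hup : ∀ c ∈ S, ∀ c' : ℝ, c ≤ c' → c' ∈ S)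
    (hinf : ∀ c : ℝ, (∀ s ∈ S, c ≤ s) → (∀ ε > (0 : ℝ), ∃ s ∈ S, s < c + ε) → c ∈ S)
    (hlow : ∀ c ∈ S, w < c → ∃ c' ∈ S, c' < c) : Set.Ici w ⊆ S := by
  have hIoi := march_reaches_wall S w hne hup hinf hlow
  intro c hc
  rcases (mem_Ici.1 hc).eq_or_lt with h | h
  · -- the wall itself: either some conquered level lies at or below it, or it is the infimum
    subst h
    by_cases hbelow : ∃ s ∈ S, s ≤ w
    · obtain ⟨s, hs, hsw⟩ := hbelow
      exact hup s hs w hsw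
    · push Not at hbelow
      refine hinf w (fun s hs ↦ (hbelow s hs).le) fun ε hε ↦ ?_
      exact ⟨w + ε / 2, hIoi (by rw [mem_Ioi]; linarith), by linarith⟩
  · exact hIoi h

end PhotonWall

end Summit.FinalStateConjecture.FinalStateConjecture.Theorems

end
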